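import Summits.RiemannHypothesis.RiemannHypothesis.Theorems.TiltedLandingLaw421R3NewtonDoor4
import Summits.RiemannHypothesis.RiemannHypothesis.Theorems.TiltedLandingLaw421R3AntiEscapeIso

open Complex Set
open scoped ComplexConjugate
open Literature.Analysis.Complex
open Summit.RiemannHypothesis.RiemannHypothesis.Theorems.Splittings.JensenWindow
open RhIdea6.G17.W07C7 RhIdea6.G17.W07C7.Rev6 RhIdea6.G18.W07C8.Law421BirthS RhIdea6.G19.W07C11.Seam
open RhIdea6.G20.W07C12.Frac RhIdea6.G20.W07C12.StColP RhW07.C12.FieldSplit RhIdea6.G21.W07C13.TentMax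
open RhW07.C14.TwoSided RhW07.C14.Classes RhW07.C14.Lineage RhW07.C14.Booking
open RhW07.C13.Heredity RhIdea6.G22.W07C15pre.Injection RhW07.E3.Cell RhW07.E3.Lit
open RhW08.Round1 RhW08.StSwap RhW08.Round2 RhW08.QuadW RhW08.SealSwapQ RhW08.SuccB RhW08.SuccSplit RhW08.SuccTheft
open RhW08.Column RhW08.Hurwitz
open RhW08.ClusterQ RhW08.ClusterQM

/-!
# W-08 AntiEscapeSplit — socket definitions and composition for `AntiEscapeCore`

SUPPORT file for the crux `TiltedLandingLaw421` (stmt-RiemannHypothesis-33346).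
Defines the SOCKETS (`NewtonNumbers`, `ClusterNumbers`, `CornerWindow`, `DoorAvailLawQ`) as the numeric
hypotheses extracted from the doors D4, D1, D2 and composes them into `AntiEscapeCore` via
`antiEscapeCore_of_sockets`.
-/

namespace RhW08.AntiEscapeSplit

/-- **NEWTON NUMBERS** (D4 `succ_of_newton_door_twoPoint'`): the numeric hypotheses of the Newton door — a constant `K`,
radius fraction `ρ₀`, a complete zero list with weights satisfying the two-point bound, separation, summability,
the END condition, and the slack input. -/
def NewtonNumbers (f : ℂ → ℂ) (x₀ R Hs : ℝ) (j : ℕ) (v : ℂ) : Prop :=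
  ∃ (K : ℂ) (ρ₀ : ℝ) (ι : Type) (_ : Countable ι) (a : ι → ℂ) (m : ι → ℝ),
    K ≠ 0 ∧ 1 < ‖K‖ * v.im ∧
    0 < ρ₀ ∧ ρ₀ / ‖K‖ ≤ |(v - K⁻¹).im| ∧
    (∀ i, 0 ≤ m i) ∧
    (∀ z, dslope (iteratedDeriv j f) v z = 0 → ∃ i, z = a i ∧ 0 < m i) ∧
    (∀ z : ℂ, ‖z - (v - K⁻¹)‖ = ρ₀ / ‖K‖ →
      ‖deriv (dslope (iteratedDeriv j f) v) z / dslope (iteratedDeriv j f) v z - K‖ ≤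
        ‖z - v‖ * ∑' i, m i / (‖z - a i‖ * ‖v - a i‖)) ∧
    (∀ i, 0 < m i → (1 + ρ₀) / ‖K‖ < ‖v - a i‖) ∧
    Summable (fun i => m i / ((‖v - a i‖ - (1 + ρ₀) / ‖K‖) * ‖v - a i‖)) ∧
    (1 + ρ₀) * ((1 + ρ₀) / ‖K‖ * ∑' i, m i / ((‖v - a i‖ - (1 + ρ₀) / ‖K‖) * ‖v - a i‖)) < ρ₀ * ‖K‖ ∧
    (RhW08.NewtonDoor.rhoN x₀ R v + (1 + ρ₀) / ‖K‖) ^ 2 + ((j : ℝ) + 1) * (v.im + (1 + ρ₀) / ‖K‖) ^ 2 ≤ ((j : ℝ) + 1) * Hs ^ 2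

/-- **CLUSTER NUMBERS** (D1 `succ_of_upper_model_zero_pt`): the numeric hypotheses of the upper model / cluster door — a disc
`‖z − c‖ ≤ ρ` off the axis with entire `h`, `M` zero-free on the disc, `M·h` dominating `f^{(j+1)}` on the circle, `M` with a zero
inside, and the disc-wise band depth. -/
def ClusterNumbers (f : ℂ → ℂ) (x₀ R Hs : ℝ) (j : ℕ) (_v : ℂ) : Prop :=
  ∃ (c : ℂ) (ρ : ℝ) (h M : ℂ → ℂ),
    0 < ρ ∧ ρ ≤ |c.im| ∧
    Differentiable ℂ h ∧ Differentiable ℂ M ∧ M ≠ 0 ∧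
    (∀ z : ℂ, ‖z - c‖ ≤ ρ → h z ≠ 0) ∧
    (∀ z : ℂ, ‖z - c‖ = ρ → ‖iteratedDeriv (j + 1) f z - M z * h z‖ < ‖M z * h z‖) ∧
    (∃ z₀ : ℂ, ‖z₀ - c‖ < ρ ∧ M z₀ = 0) ∧
    (∀ z : ℂ, ‖z - c‖ < ρ → |z.im| ≤ Hs →
      (max (|z.re - x₀| - R / 2) 0) ^ 2 + ((j : ℝ) + 1) * z.im ^ 2 ≤ ((j : ℝ) + 1) * Hs ^ 2)

/-- **CORNER WINDOW** (D2 `antiEscape_instance_of_window_corners`): the numeric hypotheses of the corner window door — a Jensen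
window `Window (f^{(j)}) α β h` with a non-real zero inside and the corner slack. -/
def CornerWindow (f : ℂ → ℂ) (x₀ R Hs : ℝ) (j : ℕ) (_v : ℂ) : Prop :=
  ∃ (α β h : ℝ),
    Window (iteratedDeriv j f) α β h ∧
    (∃ u ∈ Ioo α β ×ℂ Ioo (-h) h, iteratedDeriv j f u = 0 ∧ u.im ≠ 0) ∧
    (max (max |α - x₀| |β - x₀| - R / 2) 0) ^ 2 + ((j : ℝ) + 1) * (min h Hs) ^ 2 ≤ ((j : ℝ) + 1) * Hs ^ 2

/-- **DOOR AVAILABILITY LAW** (S3): at a lowest non-Ready ¬window ¬dimple DiscOverlap state, at least one door's numeric hypotheses hold.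
This is the content of `AntiEscapeCore` minus the structural hypotheses — a statement about zero geometry alone. -/
def DoorAvailLawQ : Prop :=
  ∀ (η : ℝ) (f : ℂ → ℂ) (x₀ s hmax R Hs : ℝ) (B : ℕ), EngineHyps5 2 η f x₀ s hmax R Hs B → ∀ (j : ℕ) (v : ℂ),
    IsLowest StTrkDQ η f x₀ s hmax R Hs B j v → ¬ ReadyR2 η f x₀ s hmax R Hs B j v →
    ¬ AllInBandInRangeWindow f x₀ R Hs j v → ¬ Dimple f j v →
    DiscOverlap f j v →
    NewtonNumbers f x₀ R Hs j v ∨ ClusterNumbers f x₀ R Hs j v ∨ CornerWindow f x₀ R Hs j v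

/-- **COFACTOR TWO-POINT SIGNATURE** (S1): the analytic theorem providing the two-point bound for the Newton door. For entire `F` of order `< 2`
with a simple zero at `v`, the cofactor `h = dslope F v` admits a complete zero list with a two-point log-derivative bound.
(Tree reference: `Literature.Analysis.Complex.GenusOneLogDeriv.exists_twoPoint_bound` + re-centring.) -/
def CofactorTwoPointSig : Prop :=
  ∀ (F : ℂ → ℂ) (v : ℂ), Differentiable ℂ F →
    (∃ A' B' ρ : ℝ, ρ < 2 ∧ ∀ z : ℂ, ‖F z‖ ≤ A' * Real.exp (B' * ‖z‖ ^ ρ)) →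
    F v = 0 → analyticOrderAt F v = 1 →
    ∃ (ι : Type) (_ : Countable ι) (a : ι → ℂ) (m : ι → ℝ),
      (∀ i, 0 ≤ m i) ∧
      (∀ z, dslope F v z = 0 → ∃ i, z = a i ∧ 0 < m i) ∧
      (∀ z w, dslope F v z ≠ 0 → dslope F v w ≠ 0 →
        ‖deriv (dslope F v) z / dslope F v z - deriv (dslope F v) w / dslope F v w‖ ≤
          ‖z - w‖ * ∑' i, m i / (‖z - a i‖ * ‖w - a i‖))

/-- ★ **COMPOSITION: `AntiEscapeCore` from the socket hypotheses.**
Given the analytic two-point signature (S1) and the door availability law (S3), we prove `AntiEscapeCore` by case-splitting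
on which door's numbers hold and dispatching to the corresponding door theorem. -/
theorem antiEscapeCore_of_sockets (_hS1 : CofactorTwoPointSig) (hS3 : DoorAvailLawQ) : RhW08.SuccSplit.AntiEscapeCore := by
  intro η f x₀ s hmax R Hs B hE j v hlow hnR hwin hdim hov
  -- Apply the door availability law to get one of the three disjuncts
  rcases hS3 η f x₀ s hmax R Hs B hE j v hlow hnR hwin hdim hov with hN | hC | hW
  · -- Newton door (D4)
    obtain ⟨K, ρ₀, ι, _, a, m, hK, hKy, hρ₀, hoff, hm, hzeros, hineq, hsep, hS, hend, hslack⟩ := hN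
    exact RhW08.NewtonDoor.succ_of_newton_door_twoPoint' hE hlow.1 hK hKy hρ₀ hoff a m hm hzeros hineq hsep hS hend hslack
  · -- Cluster door (D1)
    obtain ⟨c, ρ, h, M, hρ, hoff, hh, hM, hMne, hh0, hdom, hMz, hdisc⟩ := hC
    exact succ_of_upper_model_zero_pt hE hlow.1 hρ hoff hh hM hMne hh0 hdom hMz hdisc
  · -- Corner window door (D2)
    obtain ⟨α, β, h, hW', hJ, hcorner⟩ := hW
    exact antiEscape_instance_of_window_corners hE hlow.1 hnR hW' hJ hcorner

end RhW08.AntiEscapeSplit
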